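import Literature.Barriers.CriticalPhenomena.TimarLemma42
import HarnessLib

/-!
# Timár 2006, Lemma 4.2 — the form uniform over all deep weight windows ("there is also a
# uniform choice", proof of Thm. 4.3), PROVED

Barrier catalogue `Literature/Barriers/CriticalPhenomena/`; a brick of the programme behind the
named facts `Timar2006_noInfiniteLightClusters` (Timár's Thm. 4.3, vendored in
`TimarCriticalNonunimodular.lean`) and `Timar2006_atMostOneCriticalCluster`
(`SubexponentialGrowthZdUniqueness.lean`). Á. Timár, *Percolation on nonunimodular transitive
graphs*, Ann. Probab. 34 (2006) 2344–2364.

## What the proof of Thm. 4.3 needs from Lemma 4.2, and why the printed Lemma 4.2 gives it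

In the proof of Thm. 4.3 (pp. 2354–2355) the boxes `B_x(i; r) = B(x, r) ∩ G'(x) ∩ G(ℓ_{j+i}, ℓ_j]`
hang from a vertex `x` of the slab `G(ℓ_{j+1}, ℓ_j]` down to the ABSOLUTE level `ℓ_{j+i}`, while
the probability that "the open component of `x` in `B_x(i; r)` is good" is computed by carrying
`x` to `o` with an automorphism — which rescales all weights by `w(x)` (`autWeight_map_mul`).
Pulled back to `o`, the region above the bottom of the box becomes `{v : A < w(v)}` and the bottom
slab becomes the window `(A, A Δ⁻¹]`, where `A = Δ^{j+i+1}/w(x)` ranges over `[Δ^{i+1}, Δ^i)` as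
`x` ranges over its slab (on graphs whose weights are not all powers of one constant a slab
contains infinitely many levels, Timár 2006, p. 2353: "in other cases, there are infinitely many
levels in `L`, the weights of which form a dense set in some interval"). The printed proof asserts
(p. 2355) "Clearly, there is also a uniform choice, so that `B_x(i; r)` is good for any `x` below
`o`" — i.e. the first moment bound of Lemma 4.2 must hold UNIFORMLY in the position of the
window, not only along one grid `(Δ^{j+1}, Δ^j]`. This is exactly what the generality of the
printed Lemma 4.2 buys: it is stated for an ARBITRARY sequence `L_0, L_1, …` of pairwise disjoint
separating sets of levels coming one below the other, and the tree's proof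
(`TimarLemma42.lean`, `tsum_slabFewEvent_ne_top`) is correspondingly written for arbitrary
threshold sequences `t` with `t_{j+1} ≤ Δ t_j`.

We PROVE here the uniform statement (`exists_forall_measure_windowFewEvent_le`): on a connected,
locally finite, transitive nonunimodular graph, under Bernoulli(`p`) bond percolation with `p < 1`,
for every `k` and every `ε > 0` there is a threshold `A₀ > 0` such that for EVERY `A ∈ (0, A₀]`

  `P[ C(o) infinite and light, and the open cluster of o inside {w > A} has fewer than k`
  `    vertices in the window (A, A Δ⁻¹] ] ≤ ε`.

Proof (a diagonal argument on top of Lemma 4.2): otherwise there are `ε > 0` and bad thresholds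
below every `A₀`; choose bad `A_0 ≤ Δ²`, `A_{n+1} ≤ Δ² A_n`, and interleave them into ONE
threshold sequence `t = (A_0 Δ⁻², A_0 Δ⁻¹, A_0, A_1 Δ⁻¹, A_1, …)` (`diagThreshold`), which
satisfies `t_{j+1} ≤ Δ t_j`, `t_j ≠ 0`, `t_1 < 1`; its odd-indexed slabs are the bad windows
(`tslab_diagThreshold_odd`) with the bad regions above them (`tregion_diagThreshold_odd`), so the
bad events are contained in the events `A_{2n+1}` of the proof of Lemma 4.2
(`windowFewEvent_subset_slabFewEvent`), whose probabilities are summable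
(`tsum_slabFewEvent_ne_top`) and hence tend to `0` — contradicting `P[A_{2n+1}] > ε`.
The statement is about the cluster of `o` INSIDE the region `{w > A}` (`wregionCluster`, the
`C_j` of the printed proof of Lemma 4.2), which is the form the boxes of Thm. 4.3 consume
(the component of `o` in `B_o(i; r)` lies in it).

## References

* Á. Timár, Ann. Probab. 34 (2006) 2344–2364 (arXiv:math/0702875): Lemma 4.2 (statement for
  general separating sequences `(L_i)`), p. 2353 (dense levels), proof of Thm. 4.3, p. 2355
  ("First, we choose `i`, using Lemma 4.2 … Clearly, there is also a uniform choice, so that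
  `B_x(i; r)` is good for any `x` below `o`"). [Timar2006]
-/

noncomputable section

namespace Literature.Barriers.CriticalPhenomena

open _root_.MeasureTheory _root_.Filter Literature.Probability.Percolation
open scoped ENNReal Topology

variable {V : Type*}

/-! ### Regions, windows and the cluster of `o` inside a region, for one threshold `A` -/

/-- The region `{v : A < w(v)}` above the threshold `A` (weights `w = autWeight G o`); for
`A = t_{j+1}` this is `tregion G o t j`. [cite: Timar2006, §4 (proof of Lemma 4.2: L_j and the levels above L_j)] -/
def wregion (G : SimpleGraph V) (o : V) (A : ℝ≥0∞) : Set V :=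
  {v | A < autWeight G o v}

/-- The window `(A, A Δ⁻¹] = {v : A < w(v) ≤ A Δ⁻¹}` of ratio `Δ⁻¹` above the threshold `A`
(`Δ = minNbrWeight G o`): one separating set of levels. For `A = Δ^{j+1}` it is the grid slab
`G(ℓ_{j+1}, ℓ_j]`; in the proof of Thm. 4.3 it is the bottom slab of a box seen from its top
vertex. [cite: Timar2006, §4 (separating sets of levels; proof of Thm. 4.3)] -/
def wwindow (G : SimpleGraph V) [G.LocallyFinite] (o : V) (A : ℝ≥0∞) : Set V :=
  {v | A < autWeight G o v ∧ autWeight G o v ≤ A * (minNbrWeight G o)⁻¹}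

/-- The open cluster of `o` inside the region `{w > A}` (open paths all of whose vertices have
weight `> A`): the `C_j` of the proof of Lemma 4.2. [cite: Timar2006, §4 (proof of Lemma 4.2: C_j)] -/
def wregionCluster (G : SimpleGraph V) (o : V) (A : ℝ≥0∞) (ω : BondConfig V) : Set V :=
  openClusterIn (withinGraph G (wregion G o A)) ω o

/-- The **bad event at threshold `A`**: `C(o)` is infinite and light, and the cluster of `o`
inside `{w > A}` has fewer than `k` vertices in the window `(A, A Δ⁻¹]`.
[cite: Timar2006, §4 (Lemma 4.2; proof of Thm. 4.3, first property of being good)] -/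
def windowFewEvent (G : SimpleGraph V) [G.LocallyFinite] (o : V) (A : ℝ≥0∞) (k : ℕ) :
    Set (BondConfig V) :=
  {ω | (openCluster ω o).Infinite ∧ ¬ IsHeavy G o (openCluster ω o) ∧
    (wregionCluster G o A ω ∩ wwindow G o A).encard < k}

/-- The region cluster lies in the open cluster of `o`. [folklore] -/
theorem wregionCluster_subset_openCluster (G : SimpleGraph V) (o : V) (A : ℝ≥0∞)
    (ω : BondConfig V) : wregionCluster G o A ω ⊆ openCluster ω o :=
  openClusterIn_subset_openCluster _ ω o

/-! ### The interleaved threshold sequence of the diagonal argument -/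

/-- The threshold sequence `(a_0 Δ⁻², a_0 Δ⁻¹, a_0, a_1 Δ⁻¹, a_1, a_2 Δ⁻¹, a_2, …)`: its slab
number `2n+1` is the window `(a_n, a_n Δ⁻¹]`. [folklore] -/
def diagThreshold (Δ : ℝ≥0∞) (a : ℕ → ℝ≥0∞) : ℕ → ℝ≥0∞
  | 0 => a 0 * Δ⁻¹ * Δ⁻¹
  | j + 1 => a (j / 2) * if j % 2 = 0 then Δ⁻¹ else 1

/-- `t_{2n+1} = a_n Δ⁻¹`. [folklore] -/
theorem diagThreshold_odd (Δ : ℝ≥0∞) (a : ℕ → ℝ≥0∞) (n : ℕ) :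
    diagThreshold Δ a (2 * n + 1) = a n * Δ⁻¹ := by
  rw [diagThreshold]
  have h1 : 2 * n / 2 = n := by omega
  have h2 : 2 * n % 2 = 0 := by omega
  rw [h1, if_pos h2]

/-- `t_{2n+2} = a_n`. [folklore] -/
theorem diagThreshold_even (Δ : ℝ≥0∞) (a : ℕ → ℝ≥0∞) (n : ℕ) :
    diagThreshold Δ a (2 * n + 1 + 1) = a n := by
  rw [diagThreshold]
  have h1 : (2 * n + 1) / 2 = n := by omega
  have h2 : ¬ (2 * n + 1) % 2 = 0 := by omega
  rw [h1, if_neg h2, mul_one]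

/-- `t_1 = a_0 Δ⁻¹`. [folklore] -/
theorem diagThreshold_one (Δ : ℝ≥0∞) (a : ℕ → ℝ≥0∞) : diagThreshold Δ a 1 = a 0 * Δ⁻¹ := by
  have := diagThreshold_odd Δ a 0
  simpa using this

section Graph

variable {G : SimpleGraph V} [G.LocallyFinite] {o : V}

/-- The separating condition `t_{j+1} ≤ Δ t_j` for the interleaved sequence, given
`a_{n+1} ≤ Δ² a_n`. [folklore] -/
theorem diagThreshold_succ_le (hconn : G.Connected) (htr : IsGraphTransitive G)
    (hU : ¬ IsGraphUnimodular G) {a : ℕ → ℝ≥0∞}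
    (ha : ∀ n, a (n + 1) ≤ minNbrWeight G o ^ 2 * a n) (j : ℕ) :
    diagThreshold (minNbrWeight G o) a (j + 1) ≤
      minNbrWeight G o * diagThreshold (minNbrWeight G o) a j := by
  set Δ := minNbrWeight G o with hΔ
  have hΔ0 : Δ ≠ 0 := minNbrWeight_ne_zero hconn o
  have hΔT : Δ ≠ ⊤ := minNbrWeight_ne_top hconn htr hU o
  have hcancel : Δ * Δ⁻¹ = 1 := ENNReal.mul_inv_cancel hΔ0 hΔT
  obtain ⟨n, rfl | rfl⟩ := Nat.even_or_odd' j
  · -- `j = 2n`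
    cases n with
    | zero =>
      -- `t_1 = a_0 Δ⁻¹ = Δ t_0`
      show diagThreshold Δ a (0 + 1) ≤ Δ * diagThreshold Δ a 0
      rw [zero_add, diagThreshold_one, diagThreshold]
      calc a 0 * Δ⁻¹ = Δ * Δ⁻¹ * (a 0 * Δ⁻¹) := by rw [hcancel, one_mul]
        _ = Δ * (a 0 * Δ⁻¹ * Δ⁻¹) := by ring
        _ ≤ Δ * (a 0 * Δ⁻¹ * Δ⁻¹) := le_rfl
    | succ m =>
      -- `j = 2m+2`: `t_{2m+3} = a_{m+1} Δ⁻¹ ≤ Δ² a_m Δ⁻¹ = Δ a_m = Δ t_{2m+2}`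
      have hj : 2 * (m + 1) = 2 * m + 1 + 1 := by ring
      rw [hj, diagThreshold_even, show 2 * m + 1 + 1 + 1 = 2 * (m + 1) + 1 by ring,
        diagThreshold_odd]
      calc a (m + 1) * Δ⁻¹ ≤ Δ ^ 2 * a m * Δ⁻¹ := by gcongr; exact ha m
        _ = Δ * a m * (Δ * Δ⁻¹) := by ring
        _ = Δ * a m := by rw [hcancel, mul_one]
  · -- `j = 2n+1`: `t_{2n+2} = a_n = Δ (a_n Δ⁻¹) = Δ t_{2n+1}`
    rw [diagThreshold_even, diagThreshold_odd]
    calc a n = a n * (Δ * Δ⁻¹) := by rw [hcancel, mul_one]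
      _ = Δ * (a n * Δ⁻¹) := by ring
      _ ≤ Δ * (a n * Δ⁻¹) := le_rfl

/-- The interleaved thresholds are nonzero when the `a_n` are. [folklore] -/
theorem diagThreshold_ne_zero (hconn : G.Connected) (htr : IsGraphTransitive G)
    (hU : ¬ IsGraphUnimodular G) {a : ℕ → ℝ≥0∞} (ha : ∀ n, a n ≠ 0) (j : ℕ) :
    diagThreshold (minNbrWeight G o) a j ≠ 0 := by
  have hinv : (minNbrWeight G o)⁻¹ ≠ 0 :=
    ENNReal.inv_ne_zero.2 (minNbrWeight_ne_top hconn htr hU o)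
  cases j with
  | zero => exact mul_ne_zero (mul_ne_zero (ha 0) hinv) hinv
  | succ j =>
    rw [diagThreshold]
    refine mul_ne_zero (ha _) ?_
    split_ifs
    · exact hinv
    · exact one_ne_zero

/-- `t_1 < 1` as soon as `a_0 ≤ Δ²`. [folklore] -/
theorem diagThreshold_one_lt_one (hconn : G.Connected) (htr : IsGraphTransitive G)
    (hU : ¬ IsGraphUnimodular G) {a : ℕ → ℝ≥0∞} (ha0 : a 0 ≤ minNbrWeight G o ^ 2) :
    diagThreshold (minNbrWeight G o) a 1 < 1 := by
  set Δ := minNbrWeight G o with hΔ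
  have hΔ0 : Δ ≠ 0 := minNbrWeight_ne_zero hconn o
  have hΔT : Δ ≠ ⊤ := minNbrWeight_ne_top hconn htr hU o
  rw [diagThreshold_one]
  calc a 0 * Δ⁻¹ ≤ Δ ^ 2 * Δ⁻¹ := by gcongr
    _ = Δ * (Δ * Δ⁻¹) := by ring
    _ = Δ := by rw [ENNReal.mul_inv_cancel hΔ0 hΔT, mul_one]
    _ < 1 := minNbrWeight_lt_one hconn htr hU o

/-- The region above slab `2n+1` of the interleaved sequence is `{w > a_n}`. [folklore] -/
theorem tregion_diagThreshold_odd (a : ℕ → ℝ≥0∞) (n : ℕ) :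
    tregion G o (diagThreshold (minNbrWeight G o) a) (2 * n + 1) = wregion G o (a n) := by
  ext v
  simp only [tregion, wregion, Set.mem_setOf_eq, diagThreshold_even]

/-- Slab `2n+1` of the interleaved sequence is the window `(a_n, a_n Δ⁻¹]`. [folklore] -/
theorem tslab_diagThreshold_odd (a : ℕ → ℝ≥0∞) (n : ℕ) :
    tslab G o (diagThreshold (minNbrWeight G o) a) (2 * n + 1) = wwindow G o (a n) := by
  ext v
  simp only [tslab, wwindow, Set.mem_setOf_eq, diagThreshold_even, diagThreshold_odd]

/-- Hence the region cluster `C_{2n+1}` of the interleaved sequence is the cluster of `o` inside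
`{w > a_n}`. [folklore] -/
theorem regionCluster_diagThreshold_odd (a : ℕ → ℝ≥0∞) (n : ℕ) (ω : BondConfig V) :
    regionCluster G o (diagThreshold (minNbrWeight G o) a) (2 * n + 1) ω =
      wregionCluster G o (a n) ω := by
  rw [regionCluster, tregion_diagThreshold_odd, wregionCluster]

/-- **The bad event at threshold `a_n` is contained in the event `A_{2n+1}` of the proof of
Lemma 4.2** for the interleaved sequence (for configurations on `E(G)`): a light infinite `C(o)`
leaves the region `{w > a_n}`, hence through the window, so `1 ≤ |C_{2n+1} ∩ L_{2n+1}|`.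
[cite: Timar2006, §4 (proof of Lemma 4.2, first sentence: "By lightness, |C(o) ∩ L_i| ≥ 1")] -/
theorem windowFewEvent_subset_slabFewEvent (hconn : G.Connected) (htr : IsGraphTransitive G)
    (hU : ¬ IsGraphUnimodular G) {a : ℕ → ℝ≥0∞} (ha : ∀ n, a (n + 1) ≤ minNbrWeight G o ^ 2 * a n)
    (ha0 : a 0 ≤ minNbrWeight G o ^ 2) (hane : ∀ n, a n ≠ 0) (k n : ℕ) {ω : BondConfig V}
    (hω : ω ⊆ G.edgeSet) (hbad : ω ∈ windowFewEvent G o (a n) k) :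
    ω ∈ slabFewEvent G o (diagThreshold (minNbrWeight G o) a) k (2 * n + 1) := by
  obtain ⟨hinf, hlight, hfew⟩ := hbad
  have hsep := diagThreshold_succ_le hconn htr hU ha
  have ht0 : ∀ j, diagThreshold (minNbrWeight G o) a j ≠ 0 :=
    diagThreshold_ne_zero hconn htr hU hane
  have ht1 := diagThreshold_one_lt_one hconn htr hU ha0
  refine ⟨?_, ?_⟩
  · rw [Set.one_le_encard_iff_nonempty]
    exact regionCluster_inter_tslab_nonempty hconn htr hU hsep
      (mem_tregion_self hconn htr hU hsep ht1 _) hω (not_subset_tregion_of_light ht0 hinf hlight)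
  · rwa [regionCluster_diagThreshold_odd, tslab_diagThreshold_odd]

/-! ### The uniform Lemma 4.2 -/

/-- **Timár 2006, Lemma 4.2 in the form uniform over all deep windows, PROVED** (the "uniform
choice" of the proof of Thm. 4.3, p. 2355). On a connected, locally finite, transitive
nonunimodular graph, under Bernoulli(`p`) bond percolation with `p < 1`: for every `k` and every
`ε > 0` there is `A₀ > 0` such that for every threshold `0 < A ≤ A₀`, the probability that `C(o)`
is infinite and light while the cluster of `o` inside `{w > A}` has fewer than `k` vertices in the
window `(A, A Δ⁻¹]` is at most `ε`.
[cite: Timar2006, Lemma 4.2 and proof of Thm. 4.3 (p. 2355, "Clearly, there is also a uniform choice")] -/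
theorem exists_forall_measure_windowFewEvent_le [Countable V] (hconn : G.Connected)
    (htr : IsGraphTransitive G) (hU : ¬ IsGraphUnimodular G) {p : unitInterval}
    (hp : (p : ℝ) < 1) (k : ℕ) {ε : ℝ≥0∞} (hε : 0 < ε) :
    ∃ A₀ : ℝ≥0∞, 0 < A₀ ∧ ∀ A : ℝ≥0∞, 0 < A → A ≤ A₀ →
      bondPercolation G p (windowFewEvent G o A k) ≤ ε := by
  set Δ := minNbrWeight G o with hΔ
  have hΔ0 : Δ ≠ 0 := minNbrWeight_ne_zero hconn o
  have hΔ2 : 0 < Δ ^ 2 := pos_iff_ne_zero.2 (pow_ne_zero _ hΔ0)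
  by_contra H
  push Not at H
  -- `H : ∀ A₀, 0 < A₀ → ∃ A, 0 < A ∧ A ≤ A₀ ∧ ε < P[bad A]`; a total choice function
  choose f hf0 hfle hfε using H
  let g : ℝ≥0∞ → ℝ≥0∞ := fun A₀ => if h : 0 < A₀ then f A₀ h else 1
  have hg : ∀ {A₀ : ℝ≥0∞}, 0 < A₀ → 0 < g A₀ ∧ g A₀ ≤ A₀ ∧
      ε < bondPercolation G p (windowFewEvent G o (g A₀) k) := by
    intro A₀ h
    simp only [g, dif_pos h]
    exact ⟨hf0 A₀ h, hfle A₀ h, hfε A₀ h⟩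
  -- the bad thresholds `a_0 ≤ Δ²`, `a_{n+1} ≤ Δ² a_n`
  let a : ℕ → ℝ≥0∞ := fun n => Nat.rec (g (Δ ^ 2)) (fun _ b => g (Δ ^ 2 * b)) n
  have ha_zero : a 0 = g (Δ ^ 2) := rfl
  have ha_succ : ∀ n, a (n + 1) = g (Δ ^ 2 * a n) := fun n => rfl
  have hapos : ∀ n, 0 < a n := by
    intro n
    induction n with
    | zero => rw [ha_zero]; exact (hg hΔ2).1
    | succ m ih => rw [ha_succ]; exact (hg (ENNReal.mul_pos hΔ2.ne' ih.ne')).1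
  have hane : ∀ n, a n ≠ 0 := fun n => (hapos n).ne'
  have ha0 : a 0 ≤ Δ ^ 2 := by rw [ha_zero]; exact (hg hΔ2).2.1
  have ha : ∀ n, a (n + 1) ≤ Δ ^ 2 * a n := fun n => by
    rw [ha_succ]; exact (hg (ENNReal.mul_pos hΔ2.ne' (hane n))).2.1
  have haε : ∀ n, ε < bondPercolation G p (windowFewEvent G o (a n) k) := by
    intro n
    cases n with
    | zero => rw [ha_zero]; exact (hg hΔ2).2.2
    | succ m => rw [ha_succ]; exact (hg (ENNReal.mul_pos hΔ2.ne' (hane m))).2.2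
  -- the interleaved threshold sequence and Lemma 4.2 for it
  set t := diagThreshold Δ a with ht
  have hsep : ∀ j, t (j + 1) ≤ minNbrWeight G o * t j := diagThreshold_succ_le hconn htr hU ha
  have ht1 : t 1 < 1 := diagThreshold_one_lt_one hconn htr hU ha0
  have hsum := tsum_slabFewEvent_ne_top hconn htr hU hsep ht1 hp k
  have htend := ENNReal.tendsto_atTop_zero_of_tsum_ne_top hsum
  -- along the odd indices the events `A_{2n+1}` contain the bad events
  have hodd : Tendsto (fun n : ℕ => 2 * n + 1) atTop atTop :=
    tendsto_atTop_atTop.2 fun b => ⟨b, fun n hn => by omega⟩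
  have hev := (tendsto_order.1 (htend.comp hodd)).2 ε hε
  obtain ⟨n, hn⟩ := hev.exists
  have hle : bondPercolation G p (windowFewEvent G o (a n) k) ≤
      bondPercolation G p (slabFewEvent G o t k (2 * n + 1)) := by
    refine measure_mono_ae ?_
    have hωE : ∀ᵐ ω ∂(bondPercolation G p), ω ⊆ G.edgeSet :=
      ProbabilityTheory.setBernoulli_ae_subset
    filter_upwards [hωE] with ω hω hbad
    exact windowFewEvent_subset_slabFewEvent hconn htr hU ha ha0 hane k n hω hbad
  exact absurd (lt_of_lt_of_le (haε n) hle) (not_lt.2 (le_of_lt hn))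

end Graph

end Literature.Barriers.CriticalPhenomena

end
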